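import Summits.Ventures.PercRepro.RankLevelSetExplicitLin2KeyL

/-!
# PercRepro — THE LEVEL-16 THEOREM-M ROW OF C-025: THE KEY AT `p = 73 807`, PART C: chunks 17 … 24 of 32 (p4, S4 feed)

`proofs/P4-gen18.md`. The THEOREM-M key `KeyL 16 73807 d` (RankLevelSetExplicitLin2KeyL) at the coranks of the level-16 row
`32785 … 49168`, by the kernel (`decide`, 8 chunks of 2 048); the row is assembled in
RankLevelSetExplicitLin2IndepRowSixteen. Axioms: standard.
-/

namespace PercRepro

namespace ThmN

namespace Explicit

/-- The THEOREM-M key row at `(q, p) = (16, 73 807)`, chunk 17 of 32: coranks `32785 … 34832`, by the kernel. -/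
theorem key_sixteen_indep_row_17 : ∀ t < 2048, KeyL 16 73807 (17 + (32768 + t)) := by decide +kernel

/-- The THEOREM-M key row at `(q, p) = (16, 73 807)`, chunk 18 of 32: coranks `34833 … 36880`, by the kernel. -/
theorem key_sixteen_indep_row_18 : ∀ t < 2048, KeyL 16 73807 (17 + (34816 + t)) := by decide +kernel

/-- The THEOREM-M key row at `(q, p) = (16, 73 807)`, chunk 19 of 32: coranks `36881 … 38928`, by the kernel. -/
theorem key_sixteen_indep_row_19 : ∀ t < 2048, KeyL 16 73807 (17 + (36864 + t)) := by decide +kernel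

/-- The THEOREM-M key row at `(q, p) = (16, 73 807)`, chunk 20 of 32: coranks `38929 … 40976`, by the kernel. -/
theorem key_sixteen_indep_row_20 : ∀ t < 2048, KeyL 16 73807 (17 + (38912 + t)) := by decide +kernel

/-- The THEOREM-M key row at `(q, p) = (16, 73 807)`, chunk 21 of 32: coranks `40977 … 43024`, by the kernel. -/
theorem key_sixteen_indep_row_21 : ∀ t < 2048, KeyL 16 73807 (17 + (40960 + t)) := by decide +kernel

/-- The THEOREM-M key row at `(q, p) = (16, 73 807)`, chunk 22 of 32: coranks `43025 … 45072`, by the kernel. -/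
theorem key_sixteen_indep_row_22 : ∀ t < 2048, KeyL 16 73807 (17 + (43008 + t)) := by decide +kernel

/-- The THEOREM-M key row at `(q, p) = (16, 73 807)`, chunk 23 of 32: coranks `45073 … 47120`, by the kernel. -/
theorem key_sixteen_indep_row_23 : ∀ t < 2048, KeyL 16 73807 (17 + (45056 + t)) := by decide +kernel

/-- The THEOREM-M key row at `(q, p) = (16, 73 807)`, chunk 24 of 32: coranks `47121 … 49168`, by the kernel. -/
theorem key_sixteen_indep_row_24 : ∀ t < 2048, KeyL 16 73807 (17 + (47104 + t)) := by decide +kernel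

end Explicit

end ThmN

end PercRepro
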